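import Summits.AnomalousDissipation.AnomalousDissipation.Theorems.SolenoidalFractalHomogenisationLagrangianStepVmodSfAssembly
import HarnessLib

/-!
# K1L_D (stmt-AnomalousDissipation-27980): (V_mod) flat stage, block (ff) — ASSEMBLY of the window bound from per-label bounds on FAST CLASS DATA
# (prover ad-k3l-bookkeeping-p1 g10; RULING D28-9 / D28-17 (a) assign the (ff) grid twin to the k3l lineage; helper `--supports 27980 --as helper`)

The (ff) twin of `…VmodSfAssembly` (p716711).  A fast datum `x` (Fourier coefficients vanishing on `Z`) is seen by the cell member only through its
Leray projection `x′ = P_σ x` (`hUP`), again vanishing on `Z` (domination of coefficients).  With `S` the symmetric, alone-in-class-pairs,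
non-self-conjugate set of nonzero slow labels and `v_ℓ := 2·R_ℓ x′` the class-pair parts (`fcoeff_two_smul_pairAvg`: `𝓕v_ℓ = 𝓕x′` on `±ℓ + nℤ³`, else
`0`), every frequency is charged by exactly `0` or `2` labels of `S` (`sum_fcoeff_pairParts`), so

  `x′ = ½·Σ_{ℓ∈S} v_ℓ + x_r`,   `𝓕x_r = 𝓕x′` OFF `⋃_{ℓ∈S}(±ℓ + nℤ³)` and `0` on it,   `‖x_r‖ ≤ ‖x′‖ ≤ ‖x‖`,

all pieces weakly divergence-free and vanishing on `Z`.  Class preservation of `U` (`hUcl`) confines `U v_ℓ` to the class pair of `ℓ`, so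
`⟪U v_ℓ, y⟫ = ⟪U v_ℓ, u_ℓ⟫` with `u_ℓ` the class-pair part of the test; given a UNIFORM per-label bound `|⟪U w, y⟫| ≤ η‖w‖‖y‖` for divergence-free
fast class data `w` of labels in `S` and a REST bound `|⟪U w, y⟫| ≤ η_r‖w‖‖y‖` for divergence-free `w` vanishing on `Z` and on every class pair of `S`
(tests `y` vanishing on `Z`), Cauchy–Schwarz over `S` (`sum_norm_sq_classPairPart_le`: `Σ‖v_ℓ‖² ≤ 2‖x′‖²`, `Σ‖u_ℓ‖² ≤ 2‖y‖²`) gives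

  **`abs_inner_le_of_fast_classData`**: `|⟪U x, y⟫| ≤ (η + η_r)·‖x‖·‖y‖`.

Pure bookkeeping (no PDE); `sorry`-free; NOT a proof of (ff), of the stub, of K1L_D or of AD; rung F-D1.A0.
-/

set_option linter.dupNamespace false

noncomputable section

namespace Summit.AnomalousDissipation.AnomalousDissipation.Theorems.SolenoidalFractalHomogenisation.LagrangianStep.VmodFlat

open Literature.Analysis Literature.Analysis.FluidPDE Literature.Analysis.FluidPDE.Torus Literature.Analysis.FunctionSpaces
open MeasureTheory Set Filter UnitAddTorus
open scoped ENNReal NNReal InnerProductSpace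
open OneLevelSplit
open Summit.AnomalousDissipation.AnomalousDissipation.Theorems.SolenoidalFractalHomogenisation.LagrangianStep.PropagatorSymm
  (fcoeff_two_smul_pairAvg pairAvg_mem_divFreeL2)

variable {n : ℕ}

/-! ## §1 Coefficient bookkeeping: every frequency is charged by `0` or `2` labels -/

/-- If `k` lies in the class pair of some `ℓ₀ ∈ S` then exactly the two labels `ℓ₀, −ℓ₀` of `S` charge `k`. [folklore] -/
theorem card_filter_classPair_eq_two (S : Finset (Fin 3 → ℤ)) (hSneg : ∀ k ∈ S, -k ∈ S)
    (halone : ∀ ℓ ∈ S, ∀ k ∈ S, ((∀ i, (n:ℤ) ∣ k i - ℓ i) ∨ (∀ i, (n:ℤ) ∣ k i + ℓ i)) → k = ℓ ∨ k = -ℓ)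
    (hnsc : ∀ ℓ ∈ S, ¬ (∀ i, (n:ℤ) ∣ ℓ i + ℓ i)) (k : Fin 3 → ℤ) {ℓ₀ : Fin 3 → ℤ} (hℓ₀ : ℓ₀ ∈ S)
    (hk : (∀ i, (n:ℤ) ∣ k i - ℓ₀ i) ∨ (∀ i, (n:ℤ) ∣ k i + ℓ₀ i)) :
    (S.filter fun ℓ => (∀ i, (n:ℤ) ∣ k i - ℓ i) ∨ (∀ i, (n:ℤ) ∣ k i + ℓ i)).card = 2 := by
  classical
  have hne : ℓ₀ ≠ -ℓ₀ := fun h => hnsc ℓ₀ hℓ₀ fun i => by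
    have hi := congrFun h i; simp only [Pi.neg_apply] at hi
    exact ⟨0, by linarith⟩
  have hsub : ({ℓ₀, -ℓ₀} : Finset (Fin 3 → ℤ)) ⊆ S.filter fun ℓ => (∀ i, (n:ℤ) ∣ k i - ℓ i) ∨ (∀ i, (n:ℤ) ∣ k i + ℓ i) := by
    intro ℓ hℓ
    rw [Finset.mem_insert, Finset.mem_singleton] at hℓ
    rw [Finset.mem_filter]
    rcases hℓ with rfl | rfl
    · exact ⟨hℓ₀, hk⟩
    · refine ⟨hSneg ℓ₀ hℓ₀, ?_⟩
      rcases hk with h | h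
      · right; intro i; have := h i; rwa [Pi.neg_apply, ← sub_eq_add_neg]
      · left; intro i; have := h i; rwa [Pi.neg_apply, sub_neg_eq_add]
  have h2 := card_filter_classPair_le_two S halone hnsc k
  have h1 : 2 ≤ (S.filter fun ℓ => (∀ i, (n:ℤ) ∣ k i - ℓ i) ∨ (∀ i, (n:ℤ) ∣ k i + ℓ i)).card := by
    rw [← Finset.card_pair hne]; exact Finset.card_le_card hsub
  omega

/-- **`Σ_{ℓ∈S} 𝓕(v_ℓ)(k) = 2·𝓕x(k)` if `k` lies in a class pair of `S`, else `0`** (class-pair parts `v_ℓ` of ANY `x`). [folklore] -/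
theorem sum_fcoeff_pairParts (S : Finset (Fin 3 → ℤ)) (hSneg : ∀ k ∈ S, -k ∈ S)
    (halone : ∀ ℓ ∈ S, ∀ k ∈ S, ((∀ i, (n:ℤ) ∣ k i - ℓ i) ∨ (∀ i, (n:ℤ) ∣ k i + ℓ i)) → k = ℓ ∨ k = -ℓ)
    (hnsc : ∀ ℓ ∈ S, ¬ (∀ i, (n:ℤ) ∣ ℓ i + ℓ i)) (x : V2) (v : (Fin 3 → ℤ) → V2)
    (hv : ∀ ℓ ∈ S, ∀ k, mFourierCoeff (EuclideanSpace.complexify ∘ ⇑(v ℓ)) k =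
      if ((∀ i, (n:ℤ) ∣ k i - ℓ i) ∨ (∀ i, (n:ℤ) ∣ k i + ℓ i)) then mFourierCoeff (EuclideanSpace.complexify ∘ ⇑x) k else 0)
    (k : Fin 3 → ℤ) [Decidable (∃ ℓ ∈ S, (∀ i, (n:ℤ) ∣ k i - ℓ i) ∨ (∀ i, (n:ℤ) ∣ k i + ℓ i))] :
    ∑ ℓ ∈ S, mFourierCoeff (EuclideanSpace.complexify ∘ ⇑(v ℓ)) k
      = if (∃ ℓ ∈ S, (∀ i, (n:ℤ) ∣ k i - ℓ i) ∨ (∀ i, (n:ℤ) ∣ k i + ℓ i))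
          then (2:ℂ) • mFourierCoeff (EuclideanSpace.complexify ∘ ⇑x) k else 0 := by
  classical
  rw [Finset.sum_congr rfl fun ℓ hℓ => hv ℓ hℓ k, ← Finset.sum_filter, Finset.sum_const]
  split_ifs with hex
  · obtain ⟨ℓ₀, hℓ₀, hk⟩ := hex
    rw [card_filter_classPair_eq_two S hSneg halone hnsc k hℓ₀ hk, ← Nat.cast_smul_eq_nsmul ℂ (2:ℕ)]
    norm_num
  · have h0 : (S.filter fun ℓ => (∀ i, (n:ℤ) ∣ k i - ℓ i) ∨ (∀ i, (n:ℤ) ∣ k i + ℓ i)) = ∅ := by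
      refine Finset.filter_eq_empty_iff.2 fun ℓ hℓ hkℓ => hex ⟨ℓ, hℓ, hkℓ⟩
    rw [h0, Finset.card_empty, zero_smul]

/-- Parseval domination: coefficientwise `‖𝓕a‖ ≤ ‖𝓕b‖` gives `‖a‖ ≤ ‖b‖` on `V2`. [folklore] -/
theorem norm_le_of_fcoeff_dom (a b : V2)
    (h : ∀ k, ‖mFourierCoeff (EuclideanSpace.complexify ∘ ⇑a) k‖ ≤ ‖mFourierCoeff (EuclideanSpace.complexify ∘ ⇑b) k‖) : ‖a‖ ≤ ‖b‖ := by
  have ha := hasSum_norm_sq_fcoeff a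
  have hb := hasSum_norm_sq_fcoeff b
  have hle : ‖a‖ ^ 2 ≤ ‖b‖ ^ 2 := hasSum_le (fun k => pow_le_pow_left₀ (norm_nonneg _) (h k) 2) ha hb
  exact (pow_le_pow_iff_left₀ (norm_nonneg _) (norm_nonneg _) two_ne_zero).1 hle

/-! ## §2 The assembly -/

set_option maxHeartbeats 1600000 in
/-- **ASSEMBLY OF THE (ff) WINDOW BOUND FROM PER-LABEL BOUNDS ON FAST CLASS DATA AND A REST BOUND.**  See the module docstring. -/
theorem abs_inner_le_of_fast_classData (S : Finset (Fin 3 → ℤ)) (Z : Set (Fin 3 → ℤ)) (U : V2 →L[ℝ] V2) (η ηr : ℝ)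
    (hn : 0 < n) (hSneg : ∀ k ∈ S, -k ∈ S)
    (halone : ∀ ℓ ∈ S, ∀ k ∈ S, ((∀ i, (n:ℤ) ∣ k i - ℓ i) ∨ (∀ i, (n:ℤ) ∣ k i + ℓ i)) → k = ℓ ∨ k = -ℓ)
    (hnsc : ∀ ℓ ∈ S, ¬ (∀ i, (n:ℤ) ∣ ℓ i + ℓ i)) (hη : 0 ≤ η) (hηr : 0 ≤ ηr)
    (hUP : ∀ x : V2, U x = U ((divFreeL2 (Fin 3)).starProjection x))
    (hUcl : ∀ (c : Fin 3 → ℤ) (x : V2), (∀ k', ((∀ i, (n:ℤ) ∣ k' i - c i) ∨ (∀ i, (n:ℤ) ∣ k' i + c i)) →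
        mFourierCoeff (EuclideanSpace.complexify ∘ ⇑x) k' = 0) →
      ∀ k, ((∀ i, (n:ℤ) ∣ k i - c i) ∨ (∀ i, (n:ℤ) ∣ k i + c i)) → mFourierCoeff (EuclideanSpace.complexify ∘ ⇑(U x)) k = 0)
    (hsb : ∀ ℓ ∈ S, ∀ w : V2, w ∈ divFreeL2 (Fin 3) →
      (∀ k, mFourierCoeff (EuclideanSpace.complexify ∘ ⇑w) k ≠ 0 → (∀ i, (n:ℤ) ∣ k i - ℓ i) ∨ (∀ i, (n:ℤ) ∣ k i + ℓ i)) →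
      (∀ k ∈ Z, mFourierCoeff (EuclideanSpace.complexify ∘ ⇑w) k = 0) →
      ∀ y : V2, (∀ k ∈ Z, mFourierCoeff (EuclideanSpace.complexify ∘ ⇑y) k = 0) → |⟪U w, y⟫_ℝ| ≤ η * ‖w‖ * ‖y‖)
    (hrest : ∀ w : V2, w ∈ divFreeL2 (Fin 3) → (∀ k ∈ Z, mFourierCoeff (EuclideanSpace.complexify ∘ ⇑w) k = 0) →
      (∀ ℓ ∈ S, ∀ k, ((∀ i, (n:ℤ) ∣ k i - ℓ i) ∨ (∀ i, (n:ℤ) ∣ k i + ℓ i)) → mFourierCoeff (EuclideanSpace.complexify ∘ ⇑w) k = 0) →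
      ∀ y : V2, (∀ k ∈ Z, mFourierCoeff (EuclideanSpace.complexify ∘ ⇑y) k = 0) → |⟪U w, y⟫_ℝ| ≤ ηr * ‖w‖ * ‖y‖)
    (x y : V2) (hxZ : ∀ k ∈ Z, mFourierCoeff (EuclideanSpace.complexify ∘ ⇑x) k = 0)
    (hyZ : ∀ k ∈ Z, mFourierCoeff (EuclideanSpace.complexify ∘ ⇑y) k = 0) :
    |⟪U x, y⟫_ℝ| ≤ (η + ηr) * ‖x‖ * ‖y‖ := by
  classical
  -- ### reduce to the divergence-free projection of `x`
  set x' : V2 := (divFreeL2 (Fin 3)).starProjection x with hx'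
  have hx'mem : x' ∈ divFreeL2 (Fin 3) := (divFreeL2 (Fin 3)).starProjection_apply_mem x
  have hdom : ∀ k, ‖mFourierCoeff (EuclideanSpace.complexify ∘ ⇑x') k‖ ≤ ‖mFourierCoeff (EuclideanSpace.complexify ∘ ⇑x) k‖ :=
    fun k => norm_mFourierCoeff_starProjection_le x k
  have hx'Z : ∀ k ∈ Z, mFourierCoeff (EuclideanSpace.complexify ∘ ⇑x') k = 0 := fun k hk => by
    have h := hdom k; rw [hxZ k hk, norm_zero] at h; exact norm_eq_zero.1 (le_antisymm h (norm_nonneg _))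
  have hx'le : ‖x'‖ ≤ ‖x‖ := (divFreeL2 (Fin 3)).norm_starProjection_apply_le x
  have e0 : ⟪U x, y⟫_ℝ = ⟪U x', y⟫_ℝ := by rw [← hUP x]
  -- ### the class-pair parts of `x'` and of `y`
  set v : (Fin 3 → ℤ) → V2 := fun ℓ => (2:ℝ) • ∑ j : Fin 3 → Fin n,
        (1 / (n:ℝ) ^ 3 * Real.cos (2 * Real.pi * (∑ i, (ℓ i : ℝ) * ((j i : ℕ) : ℝ)) / n)) •
          Lp.compMeasurePreserving (fun z : UnitAddTorus (Fin 3) => z + (fun i => ((((j i : ℕ) : ℝ) / n : ℝ) : UnitAddCircle)))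
            (measurePreserving_add_right volume _) x' with hvdef
  have hvc : ∀ ℓ ∈ S, ∀ k, mFourierCoeff (EuclideanSpace.complexify ∘ ⇑(v ℓ)) k
      = if ((∀ i, (n:ℤ) ∣ k i - ℓ i) ∨ (∀ i, (n:ℤ) ∣ k i + ℓ i)) then mFourierCoeff (EuclideanSpace.complexify ∘ ⇑x') k else 0 :=
    fun ℓ hℓ k => fcoeff_two_smul_pairAvg hn ℓ (hnsc ℓ hℓ) x' k
  have hvdiv : ∀ ℓ, v ℓ ∈ divFreeL2 (Fin 3) := fun ℓ => pairAvg_mem_divFreeL2 ℓ 2 hx'mem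
  set u : (Fin 3 → ℤ) → V2 := fun ℓ => (2:ℝ) • ∑ j : Fin 3 → Fin n,
        (1 / (n:ℝ) ^ 3 * Real.cos (2 * Real.pi * (∑ i, (ℓ i : ℝ) * ((j i : ℕ) : ℝ)) / n)) •
          Lp.compMeasurePreserving (fun z : UnitAddTorus (Fin 3) => z + (fun i => ((((j i : ℕ) : ℝ) / n : ℝ) : UnitAddCircle)))
            (measurePreserving_add_right volume _) y with hudef
  have huc : ∀ ℓ ∈ S, ∀ k, mFourierCoeff (EuclideanSpace.complexify ∘ ⇑(u ℓ)) k
      = if ((∀ i, (n:ℤ) ∣ k i - ℓ i) ∨ (∀ i, (n:ℤ) ∣ k i + ℓ i)) then mFourierCoeff (EuclideanSpace.complexify ∘ ⇑y) k else 0 :=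
    fun ℓ hℓ k => fcoeff_two_smul_pairAvg hn ℓ (hnsc ℓ hℓ) y k
  -- `v ℓ` is a class datum of `ℓ`, vanishing on `Z`
  have hvcl : ∀ ℓ ∈ S, ∀ k, mFourierCoeff (EuclideanSpace.complexify ∘ ⇑(v ℓ)) k ≠ 0 →
      (∀ i, (n:ℤ) ∣ k i - ℓ i) ∨ (∀ i, (n:ℤ) ∣ k i + ℓ i) := by
    intro ℓ hℓ k hk
    by_contra hcp
    rw [hvc ℓ hℓ k, if_neg hcp] at hk
    exact hk rfl
  have hvZ : ∀ ℓ ∈ S, ∀ k ∈ Z, mFourierCoeff (EuclideanSpace.complexify ∘ ⇑(v ℓ)) k = 0 := by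
    intro ℓ hℓ k hk
    rw [hvc ℓ hℓ k]
    split_ifs
    exacts [hx'Z k hk, rfl]
  -- `u ℓ` vanishes where `y` does
  have huZ : ∀ ℓ ∈ S, ∀ k ∈ Z, mFourierCoeff (EuclideanSpace.complexify ∘ ⇑(u ℓ)) k = 0 := by
    intro ℓ hℓ k hk
    rw [huc ℓ hℓ k]
    split_ifs
    exacts [hyZ k hk, rfl]
  -- `U (v ℓ)` is carried by the class pair of `ℓ` (class preservation + transitivity)
  have hUv : ∀ ℓ ∈ S, ∀ k, ¬ ((∀ i, (n:ℤ) ∣ k i - ℓ i) ∨ (∀ i, (n:ℤ) ∣ k i + ℓ i)) →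
      mFourierCoeff (EuclideanSpace.complexify ∘ ⇑(U (v ℓ))) k = 0 := by
    intro ℓ hℓ k hk
    have hvk : ∀ k', ((∀ i, (n:ℤ) ∣ k' i - k i) ∨ (∀ i, (n:ℤ) ∣ k' i + k i)) →
        mFourierCoeff (EuclideanSpace.complexify ∘ ⇑(v ℓ)) k' = 0 := by
      intro k' hk'
      rw [hvc ℓ hℓ k', if_neg]
      exact fun hk'ℓ => hk (classPair_of_classPair_of_classPair hk' hk'ℓ)
    exact hUcl k (v ℓ) hvk k (Or.inl fun i => by simp)
  -- `⟪U (v ℓ), y⟫ = ⟪U (v ℓ), u ℓ⟫`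
  have hpair_eq : ∀ ℓ ∈ S, ⟪U (v ℓ), y⟫_ℝ = ⟪U (v ℓ), u ℓ⟫_ℝ := by
    intro ℓ hℓ
    rw [← sub_eq_zero, ← inner_sub_right]
    refine inner_eq_zero_of_disjoint_fcoeff fun k => ?_
    by_cases hk : (∀ i, (n:ℤ) ∣ k i - ℓ i) ∨ (∀ i, (n:ℤ) ∣ k i + ℓ i)
    · right; rw [fcoeff_sub, huc ℓ hℓ k, if_pos hk, sub_self]
    · left; exact hUv ℓ hℓ k hk
  -- ### the rest `x_r := x' − ½ Σ v ℓ`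
  set xr : V2 := x' - (1 / 2 : ℝ) • ∑ ℓ ∈ S, v ℓ with hxr
  have hxrdiv : xr ∈ divFreeL2 (Fin 3) :=
    (divFreeL2 (Fin 3)).sub_mem hx'mem ((divFreeL2 (Fin 3)).smul_mem _ ((divFreeL2 (Fin 3)).sum_mem fun ℓ _ => hvdiv ℓ))
  have hxrc : ∀ k, mFourierCoeff (EuclideanSpace.complexify ∘ ⇑xr) k
      = if (∃ ℓ ∈ S, (∀ i, (n:ℤ) ∣ k i - ℓ i) ∨ (∀ i, (n:ℤ) ∣ k i + ℓ i)) then 0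
        else mFourierCoeff (EuclideanSpace.complexify ∘ ⇑x') k := by
    intro k
    rw [hxr, fcoeff_sub, fcoeff_smul, fcoeff_finset_sum, sum_fcoeff_pairParts S hSneg halone hnsc x' v hvc k]
    split_ifs with hex
    · rw [smul_smul]; push_cast; norm_num
    · rw [smul_zero, sub_zero]
  have hxrZ : ∀ k ∈ Z, mFourierCoeff (EuclideanSpace.complexify ∘ ⇑xr) k = 0 := fun k hk => by
    rw [hxrc k]; split_ifs; exacts [rfl, hx'Z k hk]
  have hxrS : ∀ ℓ ∈ S, ∀ k, ((∀ i, (n:ℤ) ∣ k i - ℓ i) ∨ (∀ i, (n:ℤ) ∣ k i + ℓ i)) →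
      mFourierCoeff (EuclideanSpace.complexify ∘ ⇑xr) k = 0 := fun ℓ hℓ k hk => by
    rw [hxrc k, if_pos ⟨ℓ, hℓ, hk⟩]
  have hxrle : ‖xr‖ ≤ ‖x‖ := by
    refine (norm_le_of_fcoeff_dom xr x' fun k => ?_).trans hx'le
    rw [hxrc k]; split_ifs
    · rw [norm_zero]; exact norm_nonneg _
    · exact le_rfl
  -- ### `⟪U x', y⟫ = ½ Σ_{ℓ∈S} ⟪U (v ℓ), u ℓ⟫ + ⟪U xr, y⟫`
  have hsplit : x' = (1 / 2 : ℝ) • ∑ ℓ ∈ S, v ℓ + xr := by rw [hxr]; abel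
  have hinner : ⟪U x', y⟫_ℝ = (1 / 2 : ℝ) * ∑ ℓ ∈ S, ⟪U (v ℓ), u ℓ⟫_ℝ + ⟪U xr, y⟫_ℝ := by
    conv_lhs => rw [hsplit]
    rw [map_add, map_smul, map_sum, inner_add_left, real_inner_smul_left, sum_inner, Finset.sum_congr rfl hpair_eq]
  -- ### per-label bounds and Cauchy–Schwarz over `S`
  have hterm : ∀ ℓ ∈ S, |⟪U (v ℓ), u ℓ⟫_ℝ| ≤ η * ‖v ℓ‖ * ‖u ℓ‖ :=
    fun ℓ hℓ => hsb ℓ hℓ (v ℓ) (hvdiv ℓ) (hvcl ℓ hℓ) (hvZ ℓ hℓ) (u ℓ) (huZ ℓ hℓ)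
  have hu2 : ∑ ℓ ∈ S, ‖u ℓ‖ ^ 2 ≤ 2 * ‖y‖ ^ 2 := sum_norm_sq_classPairPart_le S halone hnsc y u huc
  have hv2 : ∑ ℓ ∈ S, ‖v ℓ‖ ^ 2 ≤ 2 * ‖x'‖ ^ 2 := sum_norm_sq_classPairPart_le S halone hnsc x' v hvc
  have hCS : ∑ ℓ ∈ S, ‖v ℓ‖ * ‖u ℓ‖ ≤ Real.sqrt (∑ ℓ ∈ S, ‖v ℓ‖ ^ 2) * Real.sqrt (∑ ℓ ∈ S, ‖u ℓ‖ ^ 2) :=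
    Real.sum_mul_le_sqrt_mul_sqrt _ _ _
  have hsv : Real.sqrt (∑ ℓ ∈ S, ‖v ℓ‖ ^ 2) ≤ Real.sqrt 2 * ‖x'‖ := by
    rw [← Real.sqrt_sq (norm_nonneg x'), ← Real.sqrt_mul (by norm_num)]; exact Real.sqrt_le_sqrt hv2
  have hsu : Real.sqrt (∑ ℓ ∈ S, ‖u ℓ‖ ^ 2) ≤ Real.sqrt 2 * ‖y‖ := by
    rw [← Real.sqrt_sq (norm_nonneg y), ← Real.sqrt_mul (by norm_num)]; exact Real.sqrt_le_sqrt hu2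
  have hmain : |(1 / 2 : ℝ) * ∑ ℓ ∈ S, ⟪U (v ℓ), u ℓ⟫_ℝ| ≤ η * ‖x‖ * ‖y‖ := by
    rw [abs_mul, abs_of_pos (by norm_num : (0:ℝ) < 1 / 2)]
    have h1 : |∑ ℓ ∈ S, ⟪U (v ℓ), u ℓ⟫_ℝ| ≤ ∑ ℓ ∈ S, η * ‖v ℓ‖ * ‖u ℓ‖ :=
      (Finset.abs_sum_le_sum_abs _ _).trans (Finset.sum_le_sum hterm)
    have h2 : ∑ ℓ ∈ S, η * ‖v ℓ‖ * ‖u ℓ‖ = η * ∑ ℓ ∈ S, ‖v ℓ‖ * ‖u ℓ‖ := by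
      rw [Finset.mul_sum]; exact Finset.sum_congr rfl fun ℓ _ => by ring
    have h3 : Real.sqrt (∑ ℓ ∈ S, ‖v ℓ‖ ^ 2) * Real.sqrt (∑ ℓ ∈ S, ‖u ℓ‖ ^ 2) ≤ (Real.sqrt 2 * ‖x'‖) * (Real.sqrt 2 * ‖y‖) :=
      mul_le_mul hsv hsu (Real.sqrt_nonneg _) (by positivity)
    have h4 : (Real.sqrt 2 * ‖x'‖) * (Real.sqrt 2 * ‖y‖) = 2 * (‖x'‖ * ‖y‖) := by
      have h := Real.mul_self_sqrt (show (0:ℝ) ≤ 2 by norm_num)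
      linear_combination (‖x'‖ * ‖y‖) * h
    have h5 : ‖x'‖ * ‖y‖ ≤ ‖x‖ * ‖y‖ := mul_le_mul_of_nonneg_right hx'le (norm_nonneg _)
    have h6 : ∑ ℓ ∈ S, ‖v ℓ‖ * ‖u ℓ‖ ≤ 2 * (‖x‖ * ‖y‖) := by linarith [hCS, h3, h4, h5]
    calc 1 / 2 * |∑ ℓ ∈ S, ⟪U (v ℓ), u ℓ⟫_ℝ| ≤ 1 / 2 * (η * ∑ ℓ ∈ S, ‖v ℓ‖ * ‖u ℓ‖) := by rw [← h2]; gcongr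
      _ ≤ 1 / 2 * (η * (2 * (‖x‖ * ‖y‖))) := by gcongr
      _ = η * ‖x‖ * ‖y‖ := by ring
  have hrest' : |⟪U xr, y⟫_ℝ| ≤ ηr * ‖x‖ * ‖y‖ :=
    (hrest xr hxrdiv hxrZ hxrS y hyZ).trans (mul_le_mul_of_nonneg_right (mul_le_mul_of_nonneg_left hxrle hηr) (norm_nonneg _))
  rw [e0, hinner]
  calc |(1 / 2 : ℝ) * ∑ ℓ ∈ S, ⟪U (v ℓ), u ℓ⟫_ℝ + ⟪U xr, y⟫_ℝ|
      ≤ |(1 / 2 : ℝ) * ∑ ℓ ∈ S, ⟪U (v ℓ), u ℓ⟫_ℝ| + |⟪U xr, y⟫_ℝ| := abs_add_le _ _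
    _ ≤ η * ‖x‖ * ‖y‖ + ηr * ‖x‖ * ‖y‖ := add_le_add hmain hrest'
    _ = (η + ηr) * ‖x‖ * ‖y‖ := by ring

end Summit.AnomalousDissipation.AnomalousDissipation.Theorems.SolenoidalFractalHomogenisation.LagrangianStep.VmodFlat

end
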